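import Literature.AlgebraicGeometry.GroupSchemes.BarsottiTateGroupHom
import HarnessLib

/-!
# Points of a Barsotti–Tate group killed by `pⁿ` descend along the transition `i_n : G n ↪ G (n+1)`; powers along `i_n` ([Tate1967] §2 (2.1)–(2.2))

Layer `Literature/AlgebraicGeometry/GroupSchemes`, namespace `Literature.AlgebraicGeometry.GroupSchemes.BTGroup`.  THEOREMS ONLY (no definition,
no named fact, no instance, no notation, no `sorry`).  Cell `hodgecm-mathlib` (D-0151 ∕ D-0183 FLOOR 0), P6 «MOD programme», Row 4B, sub-desk P6b
(desk F0P6b-plan (g12)): point-level API sugar over the cartesian clause ★ `BTGroup.isPullback_incl` («`G n` is the kernel of `[pⁿ]` on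
`G (n+1)`»), generic and count-neutral (`--supports stmt-HodgeConjecture-24832`), for the σ2 sub-line
`Cruxes/HLiu418/Lines/F0_P6b_SerreTateSigma2.lean`: together with ★ `BTGroup.pow_sq_eq_one_of_comp_betaLift_eq_one` (★
`KernelOfLiftedMultipleKilledBySquare`: the kernel of `β n` is killed by `p²`) these lemmas walk a point of `Ker (β n) ⊂ B[pⁿ]` down the
tower into `B[p²]` (stubs E2a `stub_L4B1esK_kernelFiniteFlat`, E3 `stub_L4B1esT_torsionTowerOfQuotient`).  HC_CM is proved only modulo the printed
citations until rung 0 closes; nothing here is about HC.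

THE PRINT.  [Tate1967] §2 (2.1): a `p`-divisible group is an inductive system `(G_ν, i_ν)` with `i_ν : G_ν → G_{ν+1}` identifying `G_ν` with the
kernel of `p^ν` on `G_{ν+1}`; (2.2): hence `G_ν` is the kernel of `p^ν` on every `G_{ν+μ}`.  ON POINTS: a `T`-point `u` of `G (n+1)` with
`u^{pⁿ} = 1` is `v ≫ i_n` for a unique `T`-point `v` of `G n`; and `(v ≫ i_n)^k = 1 ↔ v^k = 1` (`i_n` is a monomorphic homomorphism).

* `exists_comp_incl_eq_of_pow_eq_one`, `existsUnique_comp_incl_eq_of_pow_eq_one` — one-step descent of `pⁿ`-torsion points along `i_n`;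
* `comp_incl_pow`, `comp_incl_pow_eq_one_iff` — powers along `i_n`;
* `pow_pow_eq_one_of_pow_pow_eq_one_of_le` — `u^(p^a) = 1 → a ≤ b → u^(p^b) = 1` (to feed the descent from a `p²`-kill).

## References
* [Tate1967] J. Tate, *p-divisible groups*, Proc. Conf. Local Fields (Driebergen 1966), Springer 1967, §2 (2.1)–(2.2).
* [Messing1972] W. Messing, *The Crystals Associated to Barsotti–Tate Groups*, LNM 264 (1972), Ch. I Def. (2.1) and (1.1)–(1.6).
-/

noncomputable section

universe u

open CategoryTheory CategoryTheory.Limits AlgebraicGeometry MonoidalCategory CartesianMonoidalCategory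
open scoped MonObj

namespace Literature.AlgebraicGeometry.GroupSchemes

namespace BTGroup

variable {S : Scheme.{u}} {p h : ℕ} (B : BTGroup S p h)

/-- **One-step descent of `pⁿ`-torsion points** ([Tate1967] §2 (2.1): `G n = Ker ([pⁿ] : G (n+1) → G (n+1))`, ★ `isPullback_incl`): a
`T`-point `u` of `G (n+1)` with `u^(pⁿ) = 1` factors through `i_n : G n ↪ G (n+1)`. [cite: Tate1967, §2 (2.1)] -/
theorem exists_comp_incl_eq_of_pow_eq_one (n : ℕ) {T : Over S} (u : T ⟶ B.G (n + 1))
    (hu : letI := B.grpObj (n + 1); u ^ (p ^ n) = 1) : ∃ v : T ⟶ B.G n, v ≫ B.incl n = u := by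
  letI := B.grpObj (n + 1)
  have w : u ≫ ((𝟙 (B.G (n + 1)) : B.G (n + 1) ⟶ B.G (n + 1)) ^ (p ^ n)) = toUnit T ≫ η[B.G (n + 1)] := by
    rw [MonObj.comp_pow, Category.comp_id, hu, Hom.one_def]
  exact ⟨(B.isPullback_incl n).lift u (toUnit T) w, (B.isPullback_incl n).lift_fst u (toUnit T) w⟩

/-- … and the factorisation is UNIQUE (`i_n` is a monomorphism, ★ `mono_incl`). [cite: Tate1967, §2 (2.1)] -/
theorem existsUnique_comp_incl_eq_of_pow_eq_one (n : ℕ) {T : Over S} (u : T ⟶ B.G (n + 1))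
    (hu : letI := B.grpObj (n + 1); u ^ (p ^ n) = 1) : ∃! v : T ⟶ B.G n, v ≫ B.incl n = u := by
  obtain ⟨v, hv⟩ := B.exists_comp_incl_eq_of_pow_eq_one n u hu
  haveI := B.mono_incl n
  exact ⟨v, hv, fun v' hv' => (cancel_mono (B.incl n)).mp (hv'.trans hv.symm)⟩

/-- **Powers along the transition**: `(v ≫ i_n)^k = v^k ≫ i_n` (`i_n` is a homomorphism, ★ `incl_isMonHom`). [cite: Tate1967, §2 (2.1)]
[cite: Messing1972, Ch. I Def. (2.1)] -/
theorem comp_incl_pow (n k : ℕ) {T : Over S} (v : T ⟶ B.G n) :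
    (letI := B.grpObj (n + 1); (v ≫ B.incl n) ^ k) = (letI := B.grpObj n; v ^ k) ≫ B.incl n := by
  letI := B.grpObj n
  letI := B.grpObj (n + 1)
  haveI := B.incl_isMonHom n
  rw [MonObj.pow_comp]

/-- **`i_n` preserves and reflects the order of points**: `(v ≫ i_n)^k = 1 ↔ v^k = 1` (`i_n` is a monomorphic homomorphism).
[cite: Tate1967, §2 (2.1)–(2.2)] -/
theorem comp_incl_pow_eq_one_iff (n k : ℕ) {T : Over S} (v : T ⟶ B.G n) :
    (letI := B.grpObj (n + 1); (v ≫ B.incl n) ^ k = 1) ↔ (letI := B.grpObj n; v ^ k = 1) := by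
  letI := B.grpObj n
  letI := B.grpObj (n + 1)
  haveI := B.incl_isMonHom n
  haveI := B.mono_incl n
  rw [B.comp_incl_pow n k v]
  have h1 : (1 : T ⟶ B.G (n + 1)) = (1 : T ⟶ B.G n) ≫ B.incl n := by
    rw [Hom.one_def, Hom.one_def, Category.assoc, IsMonHom.one_hom]
  rw [h1, cancel_mono]

/-- `u^(p^a) = 1 → a ≤ b → u^(p^b) = 1` in any monoid (to run the descent from a `p²`-kill down a tower of any height).
[cite: Tate1967, §2 (2.2)] -/
theorem pow_pow_eq_one_of_pow_pow_eq_one_of_le {M : Type*} [Monoid M] {u : M} {a b : ℕ} (hu : u ^ (p ^ a) = 1) (hab : a ≤ b) :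
    u ^ (p ^ b) = 1 := by
  rw [← Nat.add_sub_cancel' hab, pow_add, pow_mul, hu, one_pow]

/-- **The form used by the σ2 sub-line**: a `T`-point `u` of `G (n+3)` killed by `p²` (e.g. a point of `Ker (β (n+3))`, ★
`pow_sq_eq_one_of_comp_betaLift_eq_one`) descends to a `T`-point of `G (n+2)` killed by `p²` — iterate down to `G 2` (`p² ∣ p^(n+2)`).
[cite: Tate1967, §2 (2.1)–(2.2)] -/
theorem exists_comp_incl_eq_of_pow_sq_eq_one (n : ℕ) {T : Over S} (u : T ⟶ B.G (n + 3))
    (hu : letI := B.grpObj (n + 3); u ^ (p ^ 2) = 1) :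
    ∃ v : T ⟶ B.G (n + 2), v ≫ B.incl (n + 2) = u ∧ (letI := B.grpObj (n + 2); v ^ (p ^ 2) = 1) := by
  letI := B.grpObj (n + 3)
  have hu' : u ^ (p ^ (n + 2)) = 1 := pow_pow_eq_one_of_pow_pow_eq_one_of_le (p := p) hu (by omega)
  obtain ⟨v, hv⟩ := B.exists_comp_incl_eq_of_pow_eq_one (n + 2) u hu'
  refine ⟨v, hv, ?_⟩
  have key := B.comp_incl_pow_eq_one_iff (n + 2) (p ^ 2) v
  rw [hv] at key
  exact key.mp hu

end BTGroup

end Literature.AlgebraicGeometry.GroupSchemes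

end
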